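import Summits.QuantumFields.BalabanUV.T4Continuum.Support.SmallCouplingEntryDecaySandwich
import Summits.QuantumFields.BalabanUV.T4Continuum.Support.ColourCovariantLaplacian

/-!
# T⁴ programme, NE2 (U1a) sub-row Δ3 (`T4-U1a.S-NE2-D3-WALK°`) — WEIGHTED ROWS OF COLOUR MULTIPLICATION OPERATORS AND OF THEIR
# UNIT TRANSLATES: a unit translation moves a block by at most one; `siteMul v`, `(S_ν⊗1)ᴴ·siteMul v`, `(S_ν⊗1)·siteMul v·(S_ν⊗1)ᴴ`

NE2 formalisation swarm `b2b-balaban-t4-ne2-formalise-*`, leaf prover 05 (gen 6); file 1/2 of the supplier item «NE2-Δ3-COVLAP-HDEC» (INTENT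
CLAIMS.log 2026-08-20T15:36Z) — the bookkeeping that lets tier A's colour-covariant Laplacian (`Support/ColourCovariantLaplacian`,
t4-ne2-p1 gen 9) be read in sub-row Δ3's exponentially weighted row-sum currency (file 2 `Support/SmallCouplingEntryDecayCovariant`):
 * §1 `val_blockOf` (`v(blk x)_μ = v(x_μ)/n`), `circAbs_blockOf_sub_blockOf_tau_le`, **`torusSupNorm_blockOf_tau_le_one`** /
   `torusSupNorm_blockOf_tauInv_le_one`: a unit translation `x ↦ x ± e_ν` of a fine site moves its block by at most `1` in pv15's ℓ^∞
   torus block distance (integer bookkeeping on `B5Blocks16.bpt_val`; the wrap `n·M − 1 ↦ 0` is a distance-`1` move on the torus);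
 * §2 **`wrow_siteMul_le`** (rows of `siteMul v` `≤ (card o)·sup‖v i a b‖`), **`wrow_shiftKH_mul_siteMul_le`** (rows of
   `(S_ν⊗1)ᴴ·siteMul v` `≤ e^{δ′}·(card o)·sup‖v‖`, by §1), `shiftK_mul_siteMul_mul_conjTranspose` (`(S_ν⊗1)·siteMul v·(S_ν⊗1)ᴴ =
   siteMul (v ∘ τ_ν)`), `kron_fdiff_conjTranspose` (`(∇_ν⊗1)ᴴ = −(S_ν⊗1)ᴴ·(∇_ν⊗1)` for the natural-number lattice factor), `wrow_sub_le`.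

HONEST FRAMING (T4-DAG p. 1).  [folklore] finite bookkeeping on landed objects; no analysis; nothing printed asserted; sub-row Δ3 NOT closed;
**NE2 (U1a) NOT PROVED**; spine PROVED 0/9; NOT infinite volume, NOT a mass gap, NOT Clay.  HONEST DEPENDENCY: continuum YM on T⁴ ⇐ BetaPertH ∧
nine spine estimates (0/9 proved); BetaPertH ⇐ (D1) ∧ (D4) ∧ CAP+tail; G-an2-4 gates asym, D1 and NE2/3/4.  ABSOLUTE RULE kept; no `def`;
no `sorry`.
-/

noncomputable section

open scoped BigOperators ComplexConjugate Matrix Kronecker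
open Finset

namespace Summit.QuantumFields.BalabanUV.T4Continuum.ColourMultiplierRows

open Literature.MathematicalPhysics.QuantumFieldTheory.Balaban1983to89.B5Prop11Plancherel (Tor fine shiftM fdiff unitVec Cst)
open Literature.MathematicalPhysics.QuantumFieldTheory.Balaban1983to89.B5G183RateUnitTower (lev)
open Literature.MathematicalPhysics.QuantumFieldTheory.Balaban1983to89.B4TorusKernel (periodConst)
open Literature.MathematicalPhysics.QuantumFieldTheory.Balaban1983to89.B4TorusKernel.MultiPeriod (torusSupNorm circAbs circAbs_le_abs
  circAbs_add_mul)
open Literature.MathematicalPhysics.QuantumFieldTheory.Balaban1983to89.B4Sect5Torus (circAbs_zero circAbs_neg)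
open Literature.MathematicalPhysics.QuantumFieldTheory.Balaban1983to89.B4Sect5Proof (latticeConst)
open Literature.MathematicalPhysics.QuantumFieldTheory.Balaban1983to89.B5Blocks16 (blockOf bpt_val)
open Literature.MathematicalPhysics.QuantumFieldTheory.Balaban1983to89.B5G115SupBound (exists_eq_bpt_blockOf)
open Literature.MathematicalPhysics.QuantumFieldTheory.Balaban1983to89.B5DeltaA169 (DeltaA)
open Literature.MathematicalPhysics.QuantumFieldTheory.Balaban1983to89.B5G183Strip (kappa183)
open Literature.MathematicalPhysics.QuantumFieldTheory.Balaban1983to89.B5G183CovDecay (MD183)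
open Literature.MathematicalPhysics.QuantumFieldTheory.Balaban1983to89.B6LowerBound2153Torus (rep)
open Literature.MathematicalPhysics.QuantumFieldTheory.Balaban1983to89.B6Cov2156Torus (one_le_M)
open Summit.QuantumFields.BalabanUV.T4Continuum
open Summit.QuantumFields.BalabanUV.T4Continuum.BalabanAveragedTowerUnit (idx)
open Summit.QuantumFields.BalabanUV.T4Continuum.BackgroundResolventTower (PerturbationLaws Cpert)
open Summit.QuantumFields.BalabanUV.T4Continuum.KingPairingPlantedLaw (calDalev JpcT CJ)
open Summit.QuantumFields.BalabanUV.T4Continuum.BlockPairingGeometry (tau)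
open Summit.QuantumFields.BalabanUV.T4Continuum.AbelianCovariantLaplacian (tauInv tauInv_tau tau_tauInv star_natCast_complex)
open Summit.QuantumFields.BalabanUV.T4Continuum.BlockMultiplication (siteMul siteMul_apply siteMul_conjTranspose siteMul_sub siteMul_smul
  kron_mul_siteMul_apply)
open Summit.QuantumFields.BalabanUV.T4Continuum.FirstOrderBackgroundModel (LipschitzBackground)
open Summit.QuantumFields.BalabanUV.T4Continuum.PerturbationAlgebra (BoundedBackground)
open Summit.QuantumFields.BalabanUV.T4Continuum.ColourCovariantLaplacian (covPertC covLapC_sub_lapC_eq negConnM zfieldC Vab Zab kappaCol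
  C2col perturbationLaws_colourCovariantLaplacian)
open Summit.QuantumFields.BalabanUV.T4Continuum.NE2ColourPerturbedLayer (pertCovC pertLimC)
open Summit.QuantumFields.BalabanUV.T4Continuum.DecayRateInterpolation (EntryDecay DecayRate TwoLevelDecayRate)
open Summit.QuantumFields.BalabanUV.T4Continuum.NE2BalabanDecayRate (decayStations_pertCovC)
open Summit.QuantumFields.BalabanUV.T4Continuum.WeightedRowSumResolvent (wrow_mul_le wrow_nonneg)
open Summit.QuantumFields.BalabanUV.T4Continuum.SmallCouplingEntryDecay (torusSupNorm_rep_triangle torusSupNorm_rep_nonneg)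
open Summit.QuantumFields.BalabanUV.T4Continuum.SmallCouplingEntryDecayGrad (wrow_add_le wrow_sum_le hdec_pertCovC_firstOrder)
open Summit.QuantumFields.BalabanUV.T4Continuum.SmallCouplingEntryDecaySandwich (fdiff_kron_eq conjTranspose_shiftK_mul fdiff_kron_mul_eq
  shiftK_apply)
open Summit.QuantumFields.BalabanUV.T4Continuum.GradientRowSumTransport (weighted_row_sum_fdiff_inv_le_cubic)

variable {d : ℕ}

/-! ## §1 A unit translation moves the block by at most one -/

section Blocks

variable (n : ℕ) [NeZero n] (M : Fin (d + 1) → ℕ) [hM : ∀ μ, NeZero (M μ)]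

/-- the block coordinate is the integer quotient of the fine coordinate: `v(blockOf x)_μ = v(x_μ) / n`. [folklore] -/
theorem val_blockOf (x : Tor (fine n M)) (μ : Fin (d + 1)) : (blockOf n M x μ).val = (x μ).val / n := by
  obtain ⟨r, hr⟩ := exists_eq_bpt_blockOf n M x
  conv_rhs => rw [hr]
  rw [FreeTowerEntryDecay.bpt_val_div]

/-- coordinatewise: the blocks of `x` and `x + e_ν` differ by `0` or `−1` mod `M_μ`, so their circular distance is `≤ 1`. [folklore] -/
theorem circAbs_blockOf_sub_blockOf_tau_le (x : Tor (fine n M)) (ν μ : Fin (d + 1)) :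
    circAbs (M μ) (((blockOf n M x μ).val : ℤ) - ((blockOf n M (x + unitVec (fine n M) ν) μ).val : ℤ)) ≤ 1 := by
  have hM1 : 1 ≤ M μ := one_le_M M μ
  rw [val_blockOf, val_blockOf]
  by_cases hμ : μ = ν
  · subst hμ
    have hn : 0 < n := Nat.pos_of_ne_zero (NeZero.ne n)
    set m : ℕ := fine n M μ with hm
    have hmn : m = n * M μ := rfl
    set v : ℕ := (x μ).val with hv
    have hvlt : v < m := ZMod.val_lt _
    have hval : ((x + unitVec (fine n M) μ) μ).val = (v + 1) % m := by
      rw [Pi.add_apply, unitVec, Pi.single_eq_same, ZMod.val_add, ZMod.val_one_eq_one_mod, Nat.add_mod_mod]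
    rw [hval]
    by_cases hlt : v + 1 < m
    · -- no wrap: the quotient moves by `0` or `1`
      rw [Nat.mod_eq_of_lt hlt, Nat.succ_div]
      by_cases hdvd : n ∣ v + 1
      · rw [if_pos hdvd]
        set q : ℕ := v / n
        rw [Nat.cast_add, Nat.cast_one, show (q : ℤ) - ((q : ℤ) + 1) = -1 by ring, circAbs_neg hM1]
        exact (circAbs_le_abs hM1 1).trans (by norm_num)
      · rw [if_neg hdvd, add_zero, sub_self, circAbs_zero]; norm_num
    · -- wrap: `v + 1 = n·M`, the block goes from `M − 1` to `0`
      have heq : v + 1 = m := by omega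
      obtain ⟨K, hK⟩ : ∃ K, M μ = K + 1 := ⟨M μ - 1, by omega⟩
      have hv' : v = n * K + (n - 1) := by
        have h1 : v + 1 = n * K + n := by rw [heq, hmn, hK, mul_add_one]
        omega
      have hq : v / n = K := by
        rw [hv', Nat.mul_add_div hn, Nat.div_eq_of_lt (Nat.sub_lt hn one_pos), add_zero]
      rw [heq, Nat.mod_self, Nat.zero_div, hq, hK, Nat.cast_zero,
        show ((K : ℕ) : ℤ) - 0 = -1 + ((K + 1 : ℕ) : ℤ) * 1 by push_cast; ring, circAbs_add_mul, circAbs_neg (by omega)]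
      exact (circAbs_le_abs (by omega) 1).trans (by norm_num)
  · have hval : (x + unitVec (fine n M) ν) μ = x μ := by
      rw [Pi.add_apply, unitVec, Pi.single_eq_of_ne hμ, add_zero]
    rw [hval, sub_self, circAbs_zero]
    norm_num

/-- **A UNIT TRANSLATION MOVES THE BLOCK BY AT MOST ONE**: `|blk(x) − blk(x + e_ν)|_{T₁,∞} ≤ 1`. [folklore] -/
theorem torusSupNorm_blockOf_tau_le_one (x : Tor (fine n M)) (ν : Fin (d + 1)) :
    torusSupNorm M (rep M (blockOf n M x) - rep M (blockOf n M (x + unitVec (fine n M) ν))) ≤ 1 := by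
  unfold torusSupNorm
  refine Finset.sup'_le _ _ fun μ _ => ?_
  have h := circAbs_blockOf_sub_blockOf_tau_le n M x ν μ
  show ((circAbs (M μ) (((blockOf n M x μ).val : ℤ) - ((blockOf n M (x + unitVec (fine n M) ν) μ).val : ℤ)) : ℤ) : ℝ) ≤ 1
  exact_mod_cast h

/-- the same for the backward translation: `|blk(x) − blk(x − e_ν)|_{T₁,∞} ≤ 1`. [folklore] -/
theorem torusSupNorm_blockOf_tauInv_le_one (x : Tor (fine n M)) (ν : Fin (d + 1)) :
    torusSupNorm M (rep M (blockOf n M x) - rep M (blockOf n M (x - unitVec (fine n M) ν))) ≤ 1 := by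
  have h := torusSupNorm_blockOf_tau_le_one n M (x - unitVec (fine n M) ν) ν
  rw [sub_add_cancel] at h
  have hsymm : torusSupNorm M (rep M (blockOf n M x) - rep M (blockOf n M (x - unitVec (fine n M) ν)))
      = torusSupNorm M (rep M (blockOf n M (x - unitVec (fine n M) ν)) - rep M (blockOf n M x)) := by
    unfold torusSupNorm
    congr 1
    funext μ
    rw [show (rep M (blockOf n M x) - rep M (blockOf n M (x - unitVec (fine n M) ν))) μ
        = -((rep M (blockOf n M (x - unitVec (fine n M) ν)) - rep M (blockOf n M x)) μ) by simp only [Pi.sub_apply]; ring,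
      circAbs_neg (one_le_M M μ)]
  rw [hsymm]; exact h

end Blocks

/-! ## §2 Weighted rows of colour multiplication operators and of their backward translates -/

section Rows

variable (L : ℕ) [NeZero L] (M : Fin (d + 1) → ℕ) [hM : ∀ μ, NeZero (M μ)]
variable {o : Type*} [Fintype o] [DecidableEq o]

omit [DecidableEq o] in
/-- **WEIGHTED ROWS OF `siteMul v`**: the kernel is block-diagonal in the site, so the weight is `e^0 = 1` and the row at `(i, a)` is
`Σ_b ‖v i a b‖ ≤ (card o)·α`. [folklore] -/
theorem wrow_siteMul_le (k : ℕ) (v : idx L M k → Matrix o o ℂ) {α : ℝ} (hv : ∀ i a b, ‖v i a b‖ ≤ α) (δ' : ℝ) (i : idx L M k × o) :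
    ∑ j : idx L M k × o, Real.exp (δ' * torusSupNorm M (rep M (blockOf (lev L k) M i.1.1) - rep M (blockOf (lev L k) M j.1.1)))
        * ‖siteMul v i j‖ ≤ (Fintype.card o : ℝ) * α := by
  rw [Fintype.sum_prod_type, Finset.sum_eq_single i.1]
  · have h0 : torusSupNorm M (rep M (blockOf (lev L k) M i.1.1) - rep M (blockOf (lev L k) M i.1.1)) = 0 := by
      rw [sub_self]; unfold torusSupNorm
      refine le_antisymm (Finset.sup'_le _ _ fun μ _ => ?_) ?_
      · simp [circAbs_zero]
      · exact Finset.le_sup'_of_le _ (Finset.mem_univ 0) (by simp [circAbs_zero])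
    simp only [h0, mul_zero, Real.exp_zero, one_mul, siteMul_apply, if_true]
    calc ∑ b, ‖v i.1 i.2 b‖ ≤ ∑ _b : o, α := Finset.sum_le_sum fun b _ => hv i.1 i.2 b
      _ = (Fintype.card o : ℝ) * α := by rw [Finset.sum_const, Finset.card_univ, nsmul_eq_mul]
  · intro y _ hy
    refine Finset.sum_eq_zero fun b _ => ?_
    rw [siteMul_apply, if_neg (Ne.symm hy), norm_zero, mul_zero]
  · intro h; exact absurd (Finset.mem_univ _) h

/-- **WEIGHTED ROWS OF `(S_ν⊗1)ᴴ·siteMul v`**: the kernel couples `(x, a)` only to `(x − e_ν, b)`, one block away at most (§1), so the row is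
`≤ e^{δ′}·(card o)·α` for `0 ≤ δ′`. [folklore] -/
theorem wrow_shiftKH_mul_siteMul_le (k : ℕ) (ν : Fin (d + 1)) (v : idx L M k → Matrix o o ℂ) {α : ℝ} (hv : ∀ i a b, ‖v i a b‖ ≤ α)
    {δ' : ℝ} (hδ : 0 ≤ δ') (i : idx L M k × o) :
    ∑ j : idx L M k × o, Real.exp (δ' * torusSupNorm M (rep M (blockOf (lev L k) M i.1.1) - rep M (blockOf (lev L k) M j.1.1)))
        * ‖((shiftM (fine (lev L k) M) ν ⊗ₖ (1 : Matrix o o ℂ))ᴴ * siteMul v) i j‖ ≤ Real.exp δ' * ((Fintype.card o : ℝ) * α) := by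
  have hα : 0 ≤ α := (norm_nonneg _).trans (hv i.1 i.2 i.2)
  rw [Matrix.conjTranspose_kronecker, Matrix.conjTranspose_one, Fintype.sum_prod_type,
    Finset.sum_eq_single (tauInv (fine (lev L k) M) ν i.1)]
  · -- the one coupled site `x − e_ν`
    have hw : Real.exp (δ' * torusSupNorm M (rep M (blockOf (lev L k) M i.1.1)
        - rep M (blockOf (lev L k) M (tauInv (fine (lev L k) M) ν i.1).1))) ≤ Real.exp δ' := by
      refine Real.exp_le_exp.mpr ?_
      have h1 := torusSupNorm_blockOf_tauInv_le_one (lev L k) M i.1.1 ν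
      calc δ' * _ ≤ δ' * 1 := mul_le_mul_of_nonneg_left h1 hδ
        _ = δ' := mul_one _
    have hS : ∀ b, ‖((shiftM (fine (lev L k) M) ν)ᴴ ⊗ₖ (1 : Matrix o o ℂ) * siteMul v) i (tauInv (fine (lev L k) M) ν i.1, b)‖
        = ‖v (tauInv (fine (lev L k) M) ν i.1) i.2 b‖ := by
      intro b
      rw [kron_mul_siteMul_apply, Matrix.conjTranspose_apply]
      have : shiftM (fine (lev L k) M) ν (tauInv (fine (lev L k) M) ν i.1) i.1 = 1 := by
        simp only [shiftM, tauInv, sub_add_cancel, Prod.mk.eta, if_true]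
      rw [this, star_one, one_mul]
    simp_rw [hS]
    rw [← Finset.mul_sum]
    calc Real.exp (δ' * _) * ∑ b, ‖v (tauInv (fine (lev L k) M) ν i.1) i.2 b‖
        ≤ Real.exp δ' * ∑ _b : o, α :=
          mul_le_mul hw (Finset.sum_le_sum fun b _ => hv _ _ _) (Finset.sum_nonneg fun _ _ => norm_nonneg _) (Real.exp_pos _).le
      _ = Real.exp δ' * ((Fintype.card o : ℝ) * α) := by rw [Finset.sum_const, Finset.card_univ, nsmul_eq_mul]
  · intro y _ hy
    refine Finset.sum_eq_zero fun b _ => ?_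
    rw [kron_mul_siteMul_apply, Matrix.conjTranspose_apply]
    have : shiftM (fine (lev L k) M) ν y i.1 = 0 := by
      simp only [shiftM]
      rw [if_neg]
      intro h
      apply hy
      rw [h, tauInv]
      simp
    rw [this, star_zero, zero_mul, norm_zero, mul_zero]
  · intro h; exact absurd (Finset.mem_univ _) h

omit [Fintype o] in
/-- **TRANSLATING A COLOUR MULTIPLICATION OPERATOR**: `(S_ν⊗1)·siteMul v·(S_ν⊗1)ᴴ = siteMul (v ∘ τ_ν)`. [folklore] -/
theorem shiftK_mul_siteMul_mul_conjTranspose [Fintype o] (Nf : Fin (d + 1) → ℕ) [∀ μ, NeZero (Nf μ)] (ν : Fin (d + 1))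
    (v : Tor Nf × Fin (d + 1) → Matrix o o ℂ) :
    (shiftM Nf ν ⊗ₖ (1 : Matrix o o ℂ)) * siteMul v * (shiftM Nf ν ⊗ₖ (1 : Matrix o o ℂ))ᴴ
      = siteMul (fun i => v (tau Nf ν i)) := by
  ext i j
  rw [Matrix.mul_apply, Finset.sum_eq_single ((j.1.1 + unitVec Nf ν, j.1.2), j.2)]
  · rw [Matrix.conjTranspose_apply, shiftK_apply, if_pos rfl, star_one, mul_one, Matrix.mul_apply,
      Finset.sum_eq_single ((i.1.1 + unitVec Nf ν, i.1.2), i.2)]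
    · rw [shiftK_apply, if_pos rfl, one_mul, siteMul_apply, siteMul_apply]
      simp only [tau, Prod.mk.injEq, add_left_inj]
      by_cases h : i.1 = j.1
      · rw [if_pos (by rw [h]; exact ⟨rfl, rfl⟩), if_pos h, h]
      · rw [if_neg (fun hh => h (Prod.ext hh.1 hh.2)), if_neg h]
    · intro m _ hm; rw [shiftK_apply, if_neg hm, zero_mul]
    · intro h; exact absurd (Finset.mem_univ _) h
  · intro m _ hm
    rw [Matrix.conjTranspose_apply, shiftK_apply, if_neg hm, star_zero, mul_zero]
  · intro h; exact absurd (Finset.mem_univ _) h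

omit [Fintype o] in
/-- `(∇_ν ⊗ 1)ᴴ = −(S_ν⊗1)ᴴ·(∇_ν⊗1)` for the (real) lattice factor `n`. [folklore] -/
theorem kron_fdiff_conjTranspose [Fintype o] (Nf : Fin (d + 1) → ℕ) [∀ μ, NeZero (Nf μ)] (n : ℕ) (ν : Fin (d + 1)) :
    (fdiff Nf ((n : ℕ) : ℂ) ν ⊗ₖ (1 : Matrix o o ℂ))ᴴ
      = -((shiftM Nf ν ⊗ₖ (1 : Matrix o o ℂ))ᴴ * (fdiff Nf ((n : ℕ) : ℂ) ν ⊗ₖ (1 : Matrix o o ℂ))) := by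
  rw [fdiff_kron_eq, Matrix.conjTranspose_smul, Matrix.conjTranspose_sub, Matrix.conjTranspose_one, Matrix.mul_smul, Matrix.mul_sub,
    Matrix.mul_one, conjTranspose_shiftK_mul, ← smul_neg, neg_sub]
  congr 1
  exact star_natCast_complex n

omit [DecidableEq o] in
/-- weighted rows are subadditive under subtraction. [folklore] -/
theorem wrow_sub_le {ι : Type*} [Fintype ι] (w : ι → ι → ℝ) (hw : ∀ i j, 0 ≤ w i j) (A B : Matrix ι ι ℂ) (i : ι) :
    ∑ j, w i j * ‖(A - B) i j‖ ≤ ∑ j, w i j * ‖A i j‖ + ∑ j, w i j * ‖B i j‖ := by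
  rw [← Finset.sum_add_distrib]
  refine Finset.sum_le_sum fun j _ => ?_
  rw [Matrix.sub_apply, ← mul_add]
  exact mul_le_mul_of_nonneg_left (norm_sub_le _ _) (hw i j)

end Rows

end Summit.QuantumFields.BalabanUV.T4Continuum.ColourMultiplierRows

end
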